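import Summits.ValiantsHypothesis.ValiantsHypothesis.Theorems.BarrierLeverTropicalDetCertificatesExistNearPrincipalBlocks

/-!
# Route BarrierLever — item `TropicalDetCertificatesExistNearPrincipal`
# (stmt-ValiantsHypothesis-19448), part 2/2: the tropical certificate UT-D EXISTS at exchange
# distance ≤ 1

**Item (planner p1-g9, the `d ≤ 1` rung of the certificate conjecture UT-D =
stmt-ValiantsHypothesis-19316 `TropicalDetCertificatesExist`).** A layout is a pair of injective
maps `u, w : Fin r → Finset (Fin h)` (row / column points of the cube `{0,1}^h`). Row literals
`ρ_x a = castAdd h a` if `a ∈ x` else `natAdd h a`; column literals `τ_y c = natAdd h c` if `c ∈ y`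
else `castAdd h c`. For a weight matrix `D` on `Fin (h+h) × Fin (h+h)` the TROPICAL DETERMINANT of
the block `(x, y)` is `ω(x, y) = min_τ Σ_a D (ρ_x a) (τ_y (τ a))`. The item: if all row points but
`u i₀` reappear among the column points other than `w j₀` (so `W = (U ∖ {p}) ∪ {q}`, `p = u i₀`,
`q = w j₀`), then there are `D` and `π₀` such that `π₀` is the UNIQUE minimiser of the outer
assignment problem `σ ↦ Σ_j ω(u (σ j), w j)` (`tropicalDetCertificatesExistNearPrincipal`, the
signature of item 19448 VERBATIM). With the tree theorem
`…TropicalDet.tropicalDetCertificateSuffices` (item 19315) such a certificate makes the transversal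
layout minor `det (det H[ρ_{u i}, τ_{w j}])_{ij}` nonzero for some `H`.

**Proof (planner memo UTD-memo-g9 §3(n′), with the layout-TAILORED weight `dmat p q` of part 1).**
The direct bijection `π₀` (common points to themselves, `p ↦ q`) is extracted from the hypothesis
by counting (`exists_direct`). OUTER ARGUMENT (`sum_inf_lt`): `π₀` costs `≤ |Δ| + [p ≠ q] < h + 2`
(exchange block via the increasing cycle, identity blocks `0`); any `σ ≠ π₀` either has a block of
cost `≥ h + 2`, or all its blocks are monotone and then, by the block lower bound and the potential
`Φ` of part 1, `cost σ ≥ Σ_j |M_j| + N(σ) = (Σ_W Φ − Σ_U Φ) + N(σ) = |Δ| + N(σ)` where the number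
`N(σ)` of non-identity blocks is `≥ 1 + [p ≠ q]` (two distinct permutations differ somewhere off
`j₀`, `exists_ne_apply_ne`; `q ∉ U` unless `q = p`).

WHAT THIS IS NOT: only the exchange-distance-`≤ 1` rung (layouts one point away from a principal
layout); nothing on UT-D for general layouts (item 19316), on TT / TNS / item 19717, on crux
stmt-ValiantsHypothesis-14610, or on `VP` versus `VNP`.

References: planner memo `UTD-memo-g9.md` §3(n′) (cell valiant-natproofs);
Mulmuley–Vazirani–Vazirani 1987 (isolating a unique optimal assignment by weights) for context.
-/

-- layout Summits/ValiantsHypothesis/ValiantsHypothesis forces the duplicated namespace component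
set_option linter.dupNamespace false

namespace Summit.ValiantsHypothesis.ValiantsHypothesis.Theorems.BarrierLever.NearPrincipal

open Finset

variable {h : ℕ}

/-! ## 6. The direct assignment `π₀` -/

/-- From «every row point but `u i₀` is a column point other than `w j₀`» (and `u` injective):
a bijection `π₀` of the index set with `π₀ j₀ = i₀` and `u (π₀ j) = w j` for `j ≠ j₀`. -/
theorem exists_direct {r : ℕ} {α : Type*} (u w : Fin r → α) (hu : Function.Injective u)
    (i₀ j₀ : Fin r) (hcov : ∀ i, i ≠ i₀ → ∃ j, j ≠ j₀ ∧ w j = u i) :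
    ∃ π₀ : Equiv.Perm (Fin r), π₀ j₀ = i₀ ∧ ∀ j, j ≠ j₀ → u (π₀ j) = w j := by
  classical
  let g : Fin r → Fin r := fun i => if hi : i = i₀ then j₀ else Classical.choose (hcov i hi)
  have hg0 : g i₀ = j₀ := by simp [g]
  have hg1 : ∀ i, i ≠ i₀ → g i ≠ j₀ ∧ w (g i) = u i := by
    intro i hi
    simp only [g, dif_neg hi]
    exact Classical.choose_spec (hcov i hi)
  have hginj : Function.Injective g := by
    intro i i' hii'
    by_cases hi : i = i₀ <;> by_cases hi' : i' = i₀
    · rw [hi, hi']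
    · exfalso
      have h1 := (hg1 i' hi').1
      rw [← hii', hi, hg0] at h1
      exact h1 rfl
    · exfalso
      have h1 := (hg1 i hi).1
      rw [hii', hi', hg0] at h1
      exact h1 rfl
    · apply hu
      rw [← (hg1 i hi).2, ← (hg1 i' hi').2, hii']
  have hgbij : Function.Bijective g := Finite.injective_iff_bijective.mp hginj
  refine ⟨(Equiv.ofBijective g hgbij).symm, ?_, ?_⟩
  · apply (Equiv.ofBijective g hgbij).injective
    rw [Equiv.apply_symm_apply, Equiv.ofBijective_apply, hg0]
  · intro j hj
    have hgi : g ((Equiv.ofBijective g hgbij).symm j) = j :=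
      Equiv.ofBijective_apply_symm_apply g hgbij j
    have hi : (Equiv.ofBijective g hgbij).symm j ≠ i₀ := fun heq => hj (by rw [← hgi, heq, hg0])
    conv_rhs => rw [← hgi]
    exact ((hg1 _ hi).2).symm

/-- Two distinct permutations differ somewhere off any given point `j₀`. -/
theorem exists_ne_apply_ne {r : ℕ} (σ π₀ : Equiv.Perm (Fin r)) (hσ : σ ≠ π₀) (j₀ : Fin r) :
    ∃ j, j ≠ j₀ ∧ σ j ≠ π₀ j := by
  by_contra hcon
  push Not at hcon
  apply hσ
  refine Equiv.ext (fun j => ?_)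
  by_cases hj : j = j₀
  · subst hj
    by_contra hne
    have h1 : π₀ (π₀.symm (σ j)) = σ j := π₀.apply_symm_apply _
    have hj' : π₀.symm (σ j) ≠ j := fun heq => hne (by rw [← h1, heq])
    have h2 := hcon _ hj'
    exact hj' (σ.injective (h2.trans h1))
  · exact hcon j hj

/-! ## 7. The outer comparison -/

/-- THE OUTER ARGUMENT: for `D = dmat p q` (`p = u i₀`, `q = w j₀`) the direct assignment `π₀`
(`u (π₀ j) = w j` off `j₀`, `π₀ j₀ = i₀`) costs `|Δ| + [p ≠ q]`, and every other assignment costs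
either `≥ h + 2` (a non-monotone block) or `|Δ| + N(σ)` with `N(σ) ≥ 1 + [p ≠ q]` non-identity
blocks (potential `Φ`). -/
theorem sum_inf_lt {r : ℕ} (u w : Fin r → Finset (Fin h)) (hu : Function.Injective u)
    (hw : Function.Injective w) (i₀ j₀ : Fin r) (π₀ : Equiv.Perm (Fin r)) (hπ0 : π₀ j₀ = i₀)
    (hπ : ∀ j, j ≠ j₀ → u (π₀ j) = w j) (σ : Equiv.Perm (Fin r)) (hσ : σ ≠ π₀) :
    ∑ j, univ.inf' univ_nonempty (bsum (u i₀) (w j₀) (u (π₀ j)) (w j)) <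
      ∑ j, univ.inf' univ_nonempty (bsum (u i₀) (w j₀) (u (σ j)) (w j)) := by
  set p := u i₀ with hp
  set q := w j₀ with hq
  set Δ := symmDiff p q with hΔ
  have hcardΔ : Δ.card ≤ h := (card_le_univ _).trans (by simp)
  -- (1) the direct assignment costs at most `|Δ| + [p ≠ q]`
  have hblock0 : univ.inf' univ_nonempty (bsum p q p q) ≤ Δ.card + (if p = q then 0 else 1) := by
    by_cases hpq : p = q
    · rw [if_pos hpq]
      calc univ.inf' univ_nonempty (bsum p q p q) ≤ bsum p q p q 1 := inf'_le _ (mem_univ _)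
        _ = 0 := by
            rw [show bsum p q p q = bsum p q p p from by rw [hpq]]; exact bsum_self_one _ _ _
        _ ≤ _ := Nat.zero_le _
    · rw [if_neg hpq]
      have hne : Δ.card ≠ 0 := by
        rw [Ne, Finset.card_eq_zero, ← Finset.bot_eq_empty, hΔ, symmDiff_eq_bot]
        exact hpq
      obtain ⟨k, hk⟩ := Nat.exists_eq_succ_of_ne_zero hne
      calc univ.inf' univ_nonempty (bsum p q p q) ≤ bsum p q p q (incCycle Δ (k + 1) hk) :=
            inf'_le _ (mem_univ _)
        _ = k + 2 := bsum_incCycle p q k hk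
        _ = Δ.card + 1 := by rw [hk]
  have hup : ∑ j, univ.inf' univ_nonempty (bsum p q (u (π₀ j)) (w j)) ≤
      Δ.card + (if p = q then 0 else 1) := by
    calc ∑ j, univ.inf' univ_nonempty (bsum p q (u (π₀ j)) (w j))
        ≤ ∑ j, (if j = j₀ then Δ.card + (if p = q then 0 else 1) else 0) := by
          refine Finset.sum_le_sum (fun j _ => ?_)
          by_cases hj : j = j₀
          · rw [if_pos hj, hj, hπ0]
            exact hblock0
          · rw [if_neg hj, hπ j hj]
            calc univ.inf' univ_nonempty (bsum p q (w j) (w j)) ≤ bsum p q (w j) (w j) 1 :=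
                inf'_le _ (mem_univ _)
              _ = 0 := bsum_self_one _ _ _
              _ ≤ 0 := le_rfl
      _ = Δ.card + (if p = q then 0 else 1) := by
          rw [Finset.sum_ite_eq' univ j₀, if_pos (mem_univ _)]
  -- (2) lower bound for `σ`
  by_cases hA : ∃ j, h + 2 ≤ univ.inf' univ_nonempty (bsum p q (u (σ j)) (w j))
  · -- a block of infinite cost
    obtain ⟨j, hj⟩ := hA
    have hsingle : univ.inf' univ_nonempty (bsum p q (u (σ j)) (w j)) ≤
        ∑ j, univ.inf' univ_nonempty (bsum p q (u (σ j)) (w j)) :=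
      Finset.single_le_sum (f := fun j => univ.inf' univ_nonempty (bsum p q (u (σ j)) (w j)))
        (fun _ _ => Nat.zero_le _) (mem_univ j)
    have hup' : ∑ j, univ.inf' univ_nonempty (bsum p q (u (π₀ j)) (w j)) ≤ Δ.card + 1 :=
      hup.trans (by split_ifs <;> omega)
    omega
  push Not at hA
  -- all blocks monotone: potential bookkeeping
  have hphi : ∀ j, phi Δ q (w j) = phi Δ q (u (σ j)) + (symmDiff (u (σ j)) (w j)).card := by
    intro j
    obtain ⟨τ, -, hτ⟩ := Finset.exists_mem_eq_inf' univ_nonempty (bsum p q (u (σ j)) (w j))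
    have hlt := hA j
    rw [hτ] at hlt
    exact phi_eq_of_mono p q _ _ (mono_of_bsum_lt p q _ _ τ hlt)
  have hsumw : ∑ j, phi Δ q (w j) = ∑ i, phi Δ q (u i) + Δ.card := by
    have hj : ∀ j ∈ (univ : Finset (Fin r)),
        phi Δ q (w j) = phi Δ q (u (π₀ j)) + (if j = j₀ then Δ.card else 0) := by
      intro j _
      by_cases hj : j = j₀
      · rw [if_pos hj, hj, hπ0, ← hp, ← hq, hΔ, phi_right, phi_left, zero_add]
      · rw [if_neg hj, hπ j hj, add_zero]
    rw [Finset.sum_congr rfl hj, Finset.sum_add_distrib, Finset.sum_ite_eq' univ j₀,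
      if_pos (mem_univ _), Equiv.sum_comp π₀ (fun i => phi Δ q (u i))]
  have hsumσ : ∑ j, phi Δ q (u (σ j)) = ∑ i, phi Δ q (u i) :=
    Equiv.sum_comp σ (fun i => phi Δ q (u i))
  have hM : ∑ j, (symmDiff (u (σ j)) (w j)).card = Δ.card := by
    have h1 := hsumw
    rw [Finset.sum_congr rfl (fun j _ => hphi j), Finset.sum_add_distrib, hsumσ] at h1
    omega
  have hlow : ∑ j, ((symmDiff (u (σ j)) (w j)).card + (if u (σ j) = w j then 0 else 1)) ≤
      ∑ j, univ.inf' univ_nonempty (bsum p q (u (σ j)) (w j)) := by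
    refine Finset.sum_le_sum (fun j _ => ?_)
    exact Finset.le_inf' _ _ (fun τ _ => card_add_le_bsum p q _ _ τ)
  rw [Finset.sum_add_distrib, hM] at hlow
  -- at least `1 + [p ≠ q]` non-identity blocks
  obtain ⟨j₁, hj₁, hσj₁⟩ := exists_ne_apply_ne σ π₀ hσ j₀
  have hN : (if p = q then 0 else 1) + 1 ≤ ∑ j, (if u (σ j) = w j then 0 else 1) := by
    have h1 : (if u (σ j₁) = w j₁ then 0 else 1) = 1 := by
      rw [if_neg]
      rw [← hπ j₁ hj₁]
      exact fun heq => hσj₁ (hu heq)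
    have h0 : (if p = q then 0 else 1) ≤ (if u (σ j₀) = w j₀ then 0 else 1) := by
      by_cases hpq : p = q
      · rw [if_pos hpq]; exact Nat.zero_le _
      rw [if_neg hpq, if_neg]
      intro heq
      by_cases hi : σ j₀ = i₀
      · exact hpq (by rw [hp, hq, ← hi, heq])
      · have h2 : π₀ (π₀.symm (σ j₀)) = σ j₀ := π₀.apply_symm_apply _
        have hj' : π₀.symm (σ j₀) ≠ j₀ := fun h' => hi (by rw [← h2, h', hπ0])
        have h3 := hπ _ hj'
        rw [h2, heq] at h3
        exact hj' (hw h3.symm)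
    calc (if p = q then 0 else 1) + 1
        ≤ (if u (σ j₀) = w j₀ then 0 else 1) + (if u (σ j₁) = w j₁ then 0 else 1) := by omega
      _ = ∑ j ∈ {j₀, j₁}, (if u (σ j) = w j then 0 else 1) := by rw [Finset.sum_pair hj₁.symm]
      _ ≤ _ := Finset.sum_le_sum_of_subset_of_nonneg (subset_univ _) (fun _ _ _ => Nat.zero_le _)
  omega

/-! ## 8. The item, verbatim -/

/-- **Item stmt-ValiantsHypothesis-19448 `TropicalDetCertificatesExistNearPrincipal` (UT-D at
exchange distance ≤ 1), signature VERBATIM.** If all row points but `u i₀` reappear among the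
column points other than `w j₀`, then the tailored weight matrix `D = dmat (u i₀) (w j₀)` and the
direct assignment `π₀` form a tropical-determinant certificate: the outer assignment problem over
the tropical determinants `min_τ Σ_a D (ρ_{u (σ j)} a) (τ_{w j} (τ a))` has `π₀` as its UNIQUE
minimiser. -/
theorem tropicalDetCertificatesExistNearPrincipal :
    ∀ (h r : ℕ) (u w : Fin r → Finset (Fin h)), Function.Injective u → Function.Injective w →
    (∃ i₀ j₀ : Fin r, ∀ i, i ≠ i₀ → ∃ j, j ≠ j₀ ∧ w j = u i) →
    ∃ (D : Fin (h + h) → Fin (h + h) → ℕ) (π₀ : Equiv.Perm (Fin r)),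
      ∀ σ : Equiv.Perm (Fin r), σ ≠ π₀ →
        ∑ j, Finset.univ.inf' Finset.univ_nonempty (fun τ : Equiv.Perm (Fin h) =>
          ∑ a : Fin h, D (if a ∈ u (π₀ j) then Fin.castAdd h a else Fin.natAdd h a)
            (if τ a ∈ w j then Fin.natAdd h (τ a) else Fin.castAdd h (τ a))) <
        ∑ j, Finset.univ.inf' Finset.univ_nonempty (fun τ : Equiv.Perm (Fin h) =>
          ∑ a : Fin h, D (if a ∈ u (σ j) then Fin.castAdd h a else Fin.natAdd h a)
            (if τ a ∈ w j then Fin.natAdd h (τ a) else Fin.castAdd h (τ a))) := by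
  intro h r u w hu hw hex
  obtain ⟨i₀, j₀, hcov⟩ := hex
  obtain ⟨π₀, hπ0, hπ⟩ := exists_direct u w hu i₀ j₀ hcov
  refine ⟨dmat (u i₀) (w j₀), π₀, fun σ hσ => ?_⟩
  simp only [dmat_lit]
  exact sum_inf_lt u w hu hw i₀ j₀ π₀ hπ0 hπ σ hσ

end Summit.ValiantsHypothesis.ValiantsHypothesis.Theorems.BarrierLever.NearPrincipal
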